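import Summits.ValiantsHypothesis.ValiantsHypothesis.Theorems.TwoProducts.RankThreeAffineTops
import Summits.ValiantsHypothesis.ValiantsHypothesis.Theorems.TwoProducts.RankThreeAffineBinomial

/-!
# Rank three AFFINE, univariate compositions: `q(w)` has NO edge direction off `Xc σ w`; `J(q(u), v) = q′(u)·J(u,v)`

Toolkit for the ADDITIVELY SEPARATED located class `f₀(w₀) + f₁(w₁) + f₂(w₂)` (T1-A″) of the OPEN rung 3-AFF of the SIDE ladder «table-rank-ladder» of
crux `stmt-ValiantsHypothesis-5906` (`TwoProducts`) — val-port-1 g5, price request to val-idea-crit-8 g4 (bus 2026-08-29T07:21:30Z, after VERDICT #66 (β)).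
★ `not_isEdgeDir_aeval_of_lead`: if the carrier `w` has an axial lead `e` at `ν` (✓ `IsAxialLead`: true off the `≤ t² + t` values `Xc σ w`, ✓ `axialLead_of_not_mem`),
then for EVERY univariate `q : ℂ[X]` the composition `q(w) = Polynomial.aeval w q` has no edge in direction `ν` — Taylor-shift `q̃ := q ∘ (X + c₀)` by the constant
term `c₀` of `w` so that `q(w) = q̃(w̃)` with `w̃ = w − c₀` constant-free and uniquely topped at `e` (✓ `tailOf`, port-4 g4's toolkit); the powers `w̃^k` are uniquely
topped at `k•e` (✓ `isUniqueTop_pow`) with pairwise distinct weights `k·⟨ν,e⟩` (`⟨ν,e⟩ ≠ 0`), so `q̃(w̃)` is uniquely topped (`isUniqueTop_sum_of_dominant`) — no tie.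
Hence ★ `Eset_aeval_subset_Xc : Eset σ (Polynomial.aeval w q) ⊆ Xc σ w` for non-constant `w`, `card_Eset_aeval_le … ≤ t·t + t` for any `t`-sparse `w`
(constant `w`: `q(w)` is a constant, ✓ `Eset_C`), uniformly in `q`.  Also the chain rule for the toric Jacobian along univariate maps,
`jac_aeval : jac (Polynomial.aeval u q) v = Polynomial.aeval u (derivative q) * jac u v` (Mathlib `Derivation.map_aeval` for ✓ `jacDer`), `jac_aeval_self`.
Vocabulary BY IMPORT, nothing restated: ✓ `…RankTwoJacobian*` (tower), ✓ `…RankThreeAffineTops` (`tailOf`, `isUniqueTop_pow/_C_mul/_add_of_below`, val-port-4 g4), ✓ `…RankThreeAffineBinomial` (`Eset_C`, `jac_*`).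
HONEST LABEL: helper toolkit for a side-ladder located class of the OPEN rung 3-AFF; NOT γ; nothing here closes 5906 / `PlanarCellBound` / `ResidualLawV25`;
`TwoProducts` OPEN; 0 summit distance; VP ≠ VNP is NOT proved here or anywhere in this tree.  `--supports stmt-ValiantsHypothesis-5906 --as helper`.
No instances, no notation, no named facts. [folklore]
-/

noncomputable section
set_option linter.dupNamespace false

namespace Summit.ValiantsHypothesis.ValiantsHypothesis.Theorems.TwoProducts.RankTwoJacobian

open scoped BigOperators Pointwise Classical
open MvPolynomial

/-! ### §1 The toric Jacobian along univariate maps -/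

/-- **Chain rule along a univariate map:** `J(q(u), v) = q′(u)·J(u, v)` (Mathlib `Derivation.map_aeval` for the derivation ✓ `jacDer v`). [folklore] -/
theorem jac_aeval (u v : Poly2) (q : Polynomial ℂ) :
    jac (Polynomial.aeval u q) v = Polynomial.aeval u (Polynomial.derivative q) * jac u v := by
  rw [← jacDer_apply, (jacDer v).map_aeval q u, smul_eq_mul, jacDer_apply]

/-- `J(q(v), v) = 0`: the toric Jacobian against `v` kills every univariate function of `v`. [folklore] -/
theorem jac_aeval_self (v : Poly2) (q : Polynomial ℂ) : jac (Polynomial.aeval v q) v = 0 := by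
  rw [jac_aeval, jac_self, mul_zero]

/-- A constant carrier turns `q(w)` into a constant: `q(C c) = C (q(c))`. [folklore] -/
theorem aeval_C_eq (c : ℂ) (q : Polynomial ℂ) : Polynomial.aeval (C c : Poly2) q = C (q.eval c) := by
  rw [← MvPolynomial.algebraMap_eq, Polynomial.aeval_algebraMap_apply_eq_algebraMap_eval]

/-! ### §2 Unique tops: weights of multiples, sums with a dominant summand, the constant-free part of a carrier -/

/-- `wt ν (k • e) = k · wt ν e`. [folklore] -/
theorem wt_nsmul (ν : Fin 2 → ℝ) (k : ℕ) (e : Expo) : wt ν (k • e) = (k : ℝ) * wt ν e := by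
  simp only [wt, Finsupp.smul_apply, smul_eq_mul, Nat.cast_mul]
  ring

/-- **A sum with a DOMINANT uniquely-topped summand is uniquely topped there.** [folklore] -/
theorem isUniqueTop_sum_of_dominant {ν : Fin 2 → ℝ} {ι : Type*} (K : Finset ι) (T : ι → Poly2) {P : Expo} {k₀ : ι}
    (hk₀ : k₀ ∈ K) (h₀ : IsUniqueTop ν (T k₀) P) (hlt : ∀ k ∈ K, k ≠ k₀ → ∀ s ∈ (T k).support, wt ν s < wt ν P) :
    IsUniqueTop ν (∑ k ∈ K, T k) P := by
  rw [← Finset.add_sum_erase K T hk₀]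
  refine isUniqueTop_add_of_below h₀ fun s hs => ?_
  obtain ⟨k, hk, hsk⟩ := Finset.mem_biUnion.mp (MvPolynomial.support_sum hs)
  obtain ⟨hkne, hkK⟩ := Finset.mem_erase.mp hk
  exact hlt k hkK hkne s hsk

/-- The constant-free part `w − c₀` of a carrier with axial lead `e` is uniquely topped at `e` (its support is `S1 w`). [folklore] -/
theorem isUniqueTop_tailOf_zero {ν : Fin 2 → ℝ} {w : Poly2} {e : Expo} (hlead : IsAxialLead ν w e) : IsUniqueTop ν (tailOf w 0) e := by
  obtain ⟨he, he0, -, hdom⟩ := hlead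
  refine ⟨?_, fun s hs hse => ?_⟩
  · rw [support_tailOf]
    exact Finset.mem_erase.mpr ⟨he0, he⟩
  · rw [support_tailOf] at hs
    obtain ⟨hs0, hs'⟩ := Finset.mem_erase.mp hs
    exact hdom s hs' hs0 hse

/-- `w = (w − c₀) + c₀` in the form the Taylor shift uses: `aeval (tailOf w 0) (X + C c₀) = w`. [folklore] -/
theorem aeval_tailOf_X_add_C (w : Poly2) :
    Polynomial.aeval (tailOf w 0) (Polynomial.X + Polynomial.C (coeff 0 w)) = w := by
  rw [map_add, Polynomial.aeval_X, Polynomial.aeval_C, MvPolynomial.algebraMap_eq, C_apply]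
  have h := monomial_add_tailOf w 0
  rw [add_comm] at h
  exact h

/-! ### §3 No edge direction of `q(w)` where `w` has an axial lead -/

/-- ★ **Off the exceptional directions of the carrier, a univariate composition has NO edge direction.**  If `e` is the axial lead of `w` at `ν`,
then `Polynomial.aeval w q` is `0` or uniquely topped at `ν` — for every `q : ℂ[X]`. [folklore] -/
theorem not_isEdgeDir_aeval_of_lead {ν : Fin 2 → ℝ} {w : Poly2} {e : Expo} (hlead : IsAxialLead ν w e) (q : Polynomial ℂ) :
    ¬ IsEdgeDir ν (Polynomial.aeval w q) := by
  intro hedge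
  have hW : wt ν e ≠ 0 := hlead.2.2.1
  set u : Poly2 := tailOf w 0 with hu
  set q' : Polynomial ℂ := q.comp (Polynomial.X + Polynomial.C (coeff 0 w)) with hq'
  have hQ : Polynomial.aeval w q = Polynomial.aeval u q' := by
    rw [hq', Polynomial.aeval_comp, aeval_tailOf_X_add_C]
  by_cases hq0 : q' = 0
  · rw [hQ, hq0, map_zero] at hedge
    exact ne_zero_of_isEdgeDir hedge rfl
  have hut : IsUniqueTop ν u e := isUniqueTop_tailOf_zero hlead
  -- the Taylor-shifted composition as a sum of uniquely topped powers
  rw [hQ, Polynomial.aeval_eq_sum_range] at hedge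
  set d := q'.natDegree with hd
  set K : Finset ℕ := (Finset.range (d + 1)).filter (fun k => q'.coeff k ≠ 0) with hK
  have hdK : d ∈ K := by
    refine Finset.mem_filter.mpr ⟨Finset.self_mem_range_succ d, ?_⟩
    have : q'.leadingCoeff ≠ 0 := Polynomial.leadingCoeff_ne_zero.mpr hq0
    exact this
  obtain ⟨k₀, hk₀K, hmax⟩ := Finset.exists_max_image K (fun k => ((k : ℕ) : ℝ) * wt ν e) ⟨d, hdK⟩
  have hk₀c : q'.coeff k₀ ≠ 0 := (Finset.mem_filter.mp hk₀K).2
  -- unique top of each present summand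
  have htop : ∀ k, q'.coeff k ≠ 0 → IsUniqueTop ν (q'.coeff k • u ^ k) (k • e) := by
    intro k hk
    rw [MvPolynomial.smul_eq_C_mul]
    exact isUniqueTop_C_mul hk (isUniqueTop_pow hut k).1
  have hsum : IsUniqueTop ν (∑ k ∈ Finset.range (d + 1), q'.coeff k • u ^ k) (k₀ • e) := by
    refine isUniqueTop_sum_of_dominant (Finset.range (d + 1)) (fun k => q'.coeff k • u ^ k)
      (Finset.mem_filter.mp hk₀K).1 (htop k₀ hk₀c) ?_
    intro k hk hkne s hs
    by_cases hkc : q'.coeff k = 0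
    · simp only [hkc, zero_smul, MvPolynomial.support_zero, Finset.notMem_empty] at hs
    · have hkK : k ∈ K := Finset.mem_filter.mpr ⟨hk, hkc⟩
      have hle := hmax k hkK
      have hne : ((k : ℕ) : ℝ) * wt ν e ≠ ((k₀ : ℕ) : ℝ) * wt ν e := by
        intro h
        have := mul_right_cancel₀ hW h
        exact hkne (by exact_mod_cast this)
      have hlt : ((k : ℕ) : ℝ) * wt ν e < ((k₀ : ℕ) : ℝ) * wt ν e := lt_of_le_of_ne hle hne
      have hs' := (htop k hkc).le s hs
      rw [wt_nsmul] at hs' ⊢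
      linarith
  exact not_tie_of_utop ((isUniqueTop_iff _ _ _).mp hsum) hedge

/-- ★ **`Eset σ (q(w)) ⊆ Xc σ w`** for a non-constant carrier `w` and every `q : ℂ[X]`. [folklore] -/
theorem Eset_aeval_subset_Xc {σ : ℝ} (hσ : σ = 1 ∨ σ = -1) {w : Poly2} (hS : (S1 w).Nonempty) (q : Polynomial ℂ) :
    Eset σ (Polynomial.aeval w q) ⊆ Xc σ w := by
  intro μ hμ
  by_contra hX
  obtain ⟨e, hlead⟩ := axialLead_of_not_mem hσ hS hX
  exact not_isEdgeDir_aeval_of_lead hlead q ((mem_Eset hσ).mp hμ)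

/-- **Count:** for a `t`-sparse carrier `w` and any `q : ℂ[X]`, `|Eset σ (q(w))| ≤ t·t + t` (✓ `card_Xc_le`; constant `w` gives `∅`). [folklore] -/
theorem card_Eset_aeval_le {σ : ℝ} (hσ : σ = 1 ∨ σ = -1) {t : ℕ} {w : Poly2} (hw : w.support.card ≤ t) (q : Polynomial ℂ) :
    (Eset σ (Polynomial.aeval w q)).card ≤ t * t + t := by
  by_cases hS : (S1 w).Nonempty
  · exact (Finset.card_le_card (Eset_aeval_subset_Xc hσ hS q)).trans
      ((card_Xc_le σ w).trans (Nat.add_le_add (Nat.mul_le_mul hw hw) hw))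
  · rw [eq_C_of_S1_empty hS, aeval_C_eq, Eset_C]
    simp

end Summit.ValiantsHypothesis.ValiantsHypothesis.Theorems.TwoProducts.RankTwoJacobian

end
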